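import Mathlib
import Summits.QuantumFields.YangMills.Theses.AntiScreeningCeilings

/-!
# Route `AntiScreeningCeilings` — the anchor transfer `ScaleMonotonicity → MaximalSeparationCeiling → AxisMirrorCeiling`

Helper for the support item `MonotoneMirrorTransfer` (stmt-QuantumFields-27236), ym-idea-11 g4.  Pure logic and real arithmetic over
the route's statements: anchor at a NEAR-ONSET sub-onset resolution `σ` (a floor carrier above half the supremum of the floor carriers),
read the one-band ceiling `(C/R₂⁴)²` at the MAXIMAL admissible separation `R₂ = min(⌊ℓ⋆/σ⌋, ⌊(L-8)/4⌋) ≥ R` from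
`MaximalSeparationCeiling`, and let `ScaleMonotonicity` (anti-screening) carry it down from `t' = 2R₂+2` to every `t ∈ [2R+2, t']`;
constants `ℓ₄ := ℓ⋆/2`, `C' := 16·A·C`.  Consequently `MonotoneMirrorTransfer` follows from `SquareRootCeilings.MirrorDomination`.
No summit / leaf / NT / UV / IR statement is proved here; only implications between route items.
-/

set_option autoImplicit false

namespace Summit.QuantumFields.YangMills.Theses.AntiScreeningCeilings

/-- ANCHOR: if `s` is sub-onset for the floor predicate `P` (no `P` on `[2s,1]`) and some `sf ∈ (0,1]` carries `P`, then there is a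
floor carrier `σ ∈ (0,1]` which is itself sub-onset and lies below `2s`. (`σ` = any carrier above half the supremum of carriers.) -/
theorem anchor_exists (P : ℝ → Prop) {s sf : ℝ}
    (hsub : ∀ s' : ℝ, 2 * s ≤ s' → s' ≤ 1 → ¬ P s') (hsf0 : 0 < sf) (hsf1 : sf ≤ 1) (hPf : P sf) :
    ∃ σ : ℝ, 0 < σ ∧ σ ≤ 1 ∧ P σ ∧ (∀ s' : ℝ, 2 * σ ≤ s' → s' ≤ 1 → ¬ P s') ∧ σ < 2 * s := by
  set F : Set ℝ := {x : ℝ | 0 < x ∧ x ≤ 1 ∧ P x} with hF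
  have hne : F.Nonempty := ⟨sf, hsf0, hsf1, hPf⟩
  have hbdd : BddAbove F := ⟨1, fun x hx => hx.2.1⟩
  have hMpos : 0 < sSup F := lt_of_lt_of_le hsf0 (le_csSup hbdd ⟨hsf0, hsf1, hPf⟩)
  have hlt : sSup F / 2 < sSup F := by linarith
  obtain ⟨σ, hσF, hσ⟩ := exists_lt_of_lt_csSup hne hlt
  obtain ⟨hσ0, hσ1, hPσ⟩ := hσF
  refine ⟨σ, hσ0, hσ1, hPσ, ?_, ?_⟩
  · intro s' h2 h1 hP'
    by_cases hs'0 : 0 < s'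
    · have : s' ≤ sSup F := le_csSup hbdd ⟨hs'0, h1, hP'⟩
      linarith
    · linarith
  · by_contra h
    push Not at h
    exact hsub σ h hσ1 hPσ

/-- MAXIMAL SEPARATION: the admissible `R₂ = min(⌊ℓ⋆/σ⌋, ⌊(L-8)/4⌋)` dominates `R` and is maximal in one of the two ways. -/
theorem exists_maximal_sep {σ ℓ : ℝ} {R L : ℕ} (hσ : 0 < σ) (hR : 1 ≤ R) (hRσ : (R : ℝ) * σ < ℓ)
    (hL : 4 * R + 8 ≤ L) :
    ∃ R₂ : ℕ, R ≤ R₂ ∧ (R₂ : ℝ) * σ ≤ ℓ ∧ 4 * R₂ + 8 ≤ L ∧ (ℓ < 2 * (R₂ : ℝ) * σ ∨ L < 4 * R₂ + 12) := by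
  have hℓσ : (R : ℝ) ≤ ℓ / σ := by rw [le_div_iff₀ hσ]; exact hRσ.le
  have hRfloor : R ≤ ⌊ℓ / σ⌋₊ := Nat.le_floor hℓσ
  have hRdiv : R ≤ (L - 8) / 4 := by omega
  refine ⟨min ⌊ℓ / σ⌋₊ ((L - 8) / 4), le_min hRfloor hRdiv, ?_, ?_, ?_⟩
  · have h1 : ((min ⌊ℓ / σ⌋₊ ((L - 8) / 4) : ℕ) : ℝ) ≤ (⌊ℓ / σ⌋₊ : ℝ) := by exact_mod_cast min_le_left _ _
    have h2 : (⌊ℓ / σ⌋₊ : ℝ) ≤ ℓ / σ := Nat.floor_le (le_trans (by positivity) hℓσ)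
    have h3 := h1.trans h2
    rwa [le_div_iff₀ hσ] at h3
  · have h1 : min ⌊ℓ / σ⌋₊ ((L - 8) / 4) ≤ (L - 8) / 4 := min_le_right _ _
    omega
  · rcases le_total ⌊ℓ / σ⌋₊ ((L - 8) / 4) with h | h
    · left
      rw [min_eq_left h]
      have hlt : ℓ / σ < (⌊ℓ / σ⌋₊ : ℝ) + 1 := Nat.lt_floor_add_one _
      have h1 : (1 : ℝ) ≤ (⌊ℓ / σ⌋₊ : ℝ) := by exact_mod_cast (le_trans hR hRfloor)
      rw [div_lt_iff₀ hσ] at hlt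
      nlinarith
    · right
      rw [min_eq_right h]
      omega

/-- FINAL ALGEBRA: combine anti-screening from `t' = 2R₂+2` down to `t ≥ 2R+2` with the one-band ceiling at `R₂ ≥ R`. -/
theorem transfer_bound {A C c c' : ℝ} {R R₂ t : ℕ} (hA : 1 ≤ A) (hR : 1 ≤ R) (hRR : R ≤ R₂)
    (ht : 2 * R + 2 ≤ t)
    (hM : (t : ℝ) ^ 8 * c ≤ A * ((2 * R₂ + 2 : ℕ) : ℝ) ^ 8 * c') (hO : c' ≤ (C / (R₂ : ℝ) ^ 4) ^ 2) :
    c ≤ (16 * A * C / (R : ℝ) ^ 4) ^ 2 := by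
  have hRpos : (0 : ℝ) < R := by exact_mod_cast (lt_of_lt_of_le Nat.zero_lt_one hR)
  have hR₂pos : (0 : ℝ) < R₂ := by exact_mod_cast (lt_of_lt_of_le Nat.zero_lt_one (hR.trans hRR))
  have htpos : (0 : ℝ) < t := by exact_mod_cast (show 0 < t by omega)
  -- key comparison (2R₂+2)·R ≤ 2·t·R₂
  have hkeyN : (2 * R₂ + 2) * R ≤ 2 * t * R₂ := by nlinarith
  have hkey : (((2 * R₂ + 2 : ℕ) : ℝ)) * R ≤ 2 * (t : ℝ) * R₂ := by exact_mod_cast hkeyN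
  have hkey8 : ((((2 * R₂ + 2 : ℕ) : ℝ)) * R) ^ 8 ≤ (2 * (t : ℝ) * R₂) ^ 8 :=
    pow_le_pow_left₀ (by positivity) hkey 8
  have h1 : (t : ℝ) ^ 8 * c ≤ A * ((2 * R₂ + 2 : ℕ) : ℝ) ^ 8 * (C / (R₂ : ℝ) ^ 4) ^ 2 :=
    hM.trans (by gcongr)
  -- rewrite the target as a cleared-denominator inequality
  rw [div_pow, le_div_iff₀ (by positivity)]
  rw [div_pow] at h1
  have h2 : (t : ℝ) ^ 8 * c * ((R₂ : ℝ) ^ 4) ^ 2 ≤ A * ((2 * R₂ + 2 : ℕ) : ℝ) ^ 8 * C ^ 2 := by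
    have := mul_le_mul_of_nonneg_right h1 (show (0 : ℝ) ≤ ((R₂ : ℝ) ^ 4) ^ 2 by positivity)
    rwa [mul_assoc (A * _) , div_mul_cancel₀] at this
    exact pow_ne_zero _ (pow_ne_zero _ hR₂pos.ne')
  -- multiply h2 by R^8 and use hkey8
  have h3 : (t : ℝ) ^ 8 * (c * ((R : ℝ) ^ 4) ^ 2) * ((R₂ : ℝ) ^ 4) ^ 2
      ≤ A * C ^ 2 * ((((2 * R₂ + 2 : ℕ) : ℝ)) * R) ^ 8 := by
    have := mul_le_mul_of_nonneg_right h2 (show (0 : ℝ) ≤ ((R : ℝ) ^ 4) ^ 2 by positivity)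
    calc (t : ℝ) ^ 8 * (c * ((R : ℝ) ^ 4) ^ 2) * ((R₂ : ℝ) ^ 4) ^ 2
        = (t : ℝ) ^ 8 * c * ((R₂ : ℝ) ^ 4) ^ 2 * ((R : ℝ) ^ 4) ^ 2 := by ring
      _ ≤ A * ((2 * R₂ + 2 : ℕ) : ℝ) ^ 8 * C ^ 2 * ((R : ℝ) ^ 4) ^ 2 := this
      _ = A * C ^ 2 * ((((2 * R₂ + 2 : ℕ) : ℝ)) * R) ^ 8 := by ring
  have h4 : A * C ^ 2 * ((((2 * R₂ + 2 : ℕ) : ℝ)) * R) ^ 8 ≤ A * C ^ 2 * (2 * (t : ℝ) * R₂) ^ 8 := by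
    have hAC : 0 ≤ A * C ^ 2 := by positivity
    exact mul_le_mul_of_nonneg_left hkey8 hAC
  have h5 : A * C ^ 2 * (2 * (t : ℝ) * R₂) ^ 8 = (t : ℝ) ^ 8 * (256 * A * C ^ 2) * ((R₂ : ℝ) ^ 4) ^ 2 := by ring
  have h6 : (t : ℝ) ^ 8 * (c * ((R : ℝ) ^ 4) ^ 2) * ((R₂ : ℝ) ^ 4) ^ 2
      ≤ (t : ℝ) ^ 8 * (256 * A * C ^ 2) * ((R₂ : ℝ) ^ 4) ^ 2 := by linarith
  have h7 : c * ((R : ℝ) ^ 4) ^ 2 ≤ 256 * A * C ^ 2 := by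
    have hpos : (0 : ℝ) < (t : ℝ) ^ 8 * ((R₂ : ℝ) ^ 4) ^ 2 := by positivity
    nlinarith
  calc c * ((R : ℝ) ^ 4) ^ 2 ≤ 256 * A * C ^ 2 := h7
    _ ≤ (16 * A * C) ^ 2 := by nlinarith [sq_nonneg C, mul_nonneg (sub_nonneg.mpr hA) (sq_nonneg C)]

/-- the direct case: a ceiling at `R₂ ≥ R` is a ceiling at `R`, and `C ≤ 16·A·C`. -/
theorem weaken_bound {A C c : ℝ} {R R₂ : ℕ} (hA : 1 ≤ A) (hC : 0 ≤ C) (hR : 1 ≤ R) (hRR : R ≤ R₂)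
    (hO : c ≤ (C / (R₂ : ℝ) ^ 4) ^ 2) : c ≤ (16 * A * C / (R : ℝ) ^ 4) ^ 2 := by
  have hRpos : (0 : ℝ) < R := by exact_mod_cast (lt_of_lt_of_le Nat.zero_lt_one hR)
  have hRR' : (R : ℝ) ≤ R₂ := by exact_mod_cast hRR
  have h1 : C / (R₂ : ℝ) ^ 4 ≤ C / (R : ℝ) ^ 4 :=
    div_le_div_of_nonneg_left hC (by positivity) (pow_le_pow_left₀ hRpos.le hRR' 4)
  have h2 : C / (R : ℝ) ^ 4 ≤ 16 * A * C / (R : ℝ) ^ 4 :=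
    div_le_div_of_nonneg_right (by nlinarith) (by positivity)
  exact hO.trans (pow_le_pow_left₀ (by positivity) (h1.trans h2) 2)

/-- THE ANCHOR TRANSFER: anti-screening (`ScaleMonotonicity`) carries the one-band maximal-separation ceiling
(`MaximalSeparationCeiling`) down to every smaller separation: together they give `SquareRootCeilings.AxisMirrorCeiling`
(stmt-QuantumFields-26791) with `ℓ₄ := min ℓ_M ℓ_O / 2`, `C' := 16·A·C`. -/
theorem monotoneTransfer (hM : ScaleMonotonicity) (hO : MaximalSeparationCeiling) :
    Summit.QuantumFields.YangMills.Theses.SquareRootCeilings.AxisMirrorCeiling := by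
  intro G i1 i2 i3 i4 hG hSU r v f g h Λ₅
  obtain ⟨εA, hεA, HA⟩ := hM G hG hSU r v f g h Λ₅
  obtain ⟨εB, hεB, HB⟩ := hO G hG hSU r v f g h Λ₅
  refine ⟨min εA εB, lt_min hεA hεB, ?_⟩
  intro ε hε hεle hfl
  obtain ⟨ℓM, hℓM, HA1⟩ := HA ε hε (le_trans hεle (min_le_left _ _)) hfl
  obtain ⟨ℓO, hℓO, HB1⟩ := HB ε hε (le_trans hεle (min_le_right _ _)) hfl
  have hℓpos : 0 < min ℓM ℓO := lt_min hℓM hℓO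
  obtain ⟨A, βM, hA, HA2⟩ := HA1 (min ℓM ℓO) hℓpos (min_le_left _ _)
  obtain ⟨C, βO, hC, HB2⟩ := HB1 (min ℓM ℓO) hℓpos (min_le_right _ _)
  obtain ⟨β₅, hβ₅⟩ := hfl
  have hA0 : 0 ≤ A := le_trans zero_le_one hA
  refine ⟨16 * A * C, min ℓM ℓO / 2, max (max βM βO) β₅, half_pos hℓpos, by positivity, ?_⟩
  intro β hβ s hs hs1 hsub L q k R t hq hR hRs hL ht htL
  have hβM : βM ≤ β := le_trans (le_trans (le_max_left _ _) (le_max_left _ _)) hβ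
  have hβO : βO ≤ β := le_trans (le_trans (le_max_right _ _) (le_max_left _ _)) hβ
  -- a floor carrier at this β, and the near-onset sub-onset anchor σ < 2s
  obtain ⟨sf, hsf0, hsf1, hPf⟩ := hβ₅ β (le_trans (le_max_right _ _) hβ)
  obtain ⟨σ, hσ0, hσ1, hPσ, hσsub, hσs⟩ := anchor_exists _ hsub hsf0 hsf1 hPf
  -- the maximal admissible separation R₂ ≥ R at resolution σ
  have hRpos : (0 : ℝ) < R := by exact_mod_cast (lt_of_lt_of_le Nat.zero_lt_one hR)
  have hRσ : (R : ℝ) * σ < min ℓM ℓO := by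
    have : (R : ℝ) * σ < (R : ℝ) * (2 * s) := mul_lt_mul_of_pos_left hσs hRpos
    nlinarith
  obtain ⟨R₂, hRR₂, hR₂σ, hR₂L, hmax⟩ := exists_maximal_sep hσ0 hR hRσ hL
  have hR₂1 : 1 ≤ R₂ := hR.trans hRR₂
  have ht2 : ((2 * R₂ + 2 : ℕ) : ℝ) ≤ 2 * min ℓM ℓO / σ + 2 := by
    have h1 : (R₂ : ℝ) ≤ min ℓM ℓO / σ := by rw [le_div_iff₀ hσ0]; exact hR₂σ
    have h2 : 2 * min ℓM ℓO / σ = 2 * (min ℓM ℓO / σ) := by ring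
    push_cast
    rw [h2]
    linarith
  rcases le_or_gt t (2 * R₂ + 2) with hle | hgt
  · -- anchor at t' = 2R₂+2 (one-band ceiling), transfer down to t by anti-screening
    have hOb := HB2 β hβO σ hσ0 hσ1 hσsub ⟨σ, by linarith, hσ1, hPσ⟩ L q k R₂ (2 * R₂ + 2) hq hR₂1 hR₂σ hR₂L
      hmax le_rfl (by omega)
    have hMb := HA2 β hβM σ hσ0 hσ1 hσsub L q k t (2 * R₂ + 2) hq (by omega) hle ht2 (by omega)
    exact transfer_bound hA hR hRR₂ ht hMb hOb
  · -- t is itself in the admissible range of the one-band ceiling at R₂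
    have hOb := HB2 β hβO σ hσ0 hσ1 hσsub ⟨σ, by linarith, hσ1, hPσ⟩ L q k R₂ t hq hR₂1 hR₂σ hR₂L hmax
      (by omega) htL
    exact weaken_bound hA hC hR hRR₂ hOb

/-- Hence the support item `MonotoneMirrorTransfer` (stmt-QuantumFields-27236) follows from `SquareRootCeilings.MirrorDomination`
(stmt-QuantumFields-26792) alone. -/
theorem monotoneMirrorTransfer_of_mirrorDomination
    (hMD : Summit.QuantumFields.YangMills.Theses.SquareRootCeilings.MirrorDomination) : MonotoneMirrorTransfer :=
  fun hM hO => hMD (monotoneTransfer hM hO)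

end Summit.QuantumFields.YangMills.Theses.AntiScreeningCeilings
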